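import Literature.MathematicalPhysics.QuantumLattice.SectorisedKernelNormRefinementPlateau
import Literature.MathematicalPhysics.QuantumLattice.SectorisedKernelNormRefinementPrescribedWt
import HarnessLib

/-!
# WEIGHTED re-sectorisation of the Hubbard sector kernels across a plateau pair with prescribed legs

Topic `MathematicalPhysics/QuantumLattice`; the weighted twin of `SectorisedKernelNormRefinementPlateauPrescribed` (Hubbard layer of
`SectorisedKernelNormRefinementPrescribedWt.prescribedLegSumWt_refine_le_split`).  Setting (BGM 2006 §2.7–2.8): a thin/fat pair `F, F̃`, a finer family
`F′` in the plateau, `map E(F′) G = map (E(F′)S(F̃)) (sectorPreimage F G)` (`map_sectorAnalysis_eq_map_comp_sectorPreimage_of_plateau`), so the fine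
sectorised kernels are the leg-wise transform of `ε_x^{m+1} ·` the coarse ones by the overlap kernel `T = E(F′)S(F̃)`; the multiscale norms carry a
tree-decay WEIGHT on the leg positions ((2.77)), dominated under re-sectorisation by the coarse weight times one displacement factor per leg, each leg
paying the ω-weighted `L¹` size of `T`.

* **`hubbardSectorPrescribedSumWt_refine_le_split_of_plateau_pair`** — leg set `E ∋ p`, prescription `τ″|_E`, weights `wf ≤ wc·∏ω`, ω-weighted per-pair
  sums of `‖T‖` (`≤ c₁`, `≤ c₁r`), parents `≤ ρ`, split counts `R₁`/`R₂`, weighted coarse bounds `N₁`/`N₂`: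
  `ε_x^m Σ_{σ″ ∈ A″, σ″|_E = τ″|_E} Σ_{x″_p = x} wf(x″)‖W_{F′,σ″}(x″)‖ ≤ c₁^m · c₁r · ρ^{|E|} · ε_x^m · (ε_x · (R₁N₁ + R₂N₂))`.

Cell gate-hubbard-kl, K3 engine child clause (E1): the WEIGHTED levels track of the blocked birth-level tower (tree weight `klScaleWt`; weighted
G1-L suppliers).  Everything is proved; no definition, no named fact.

## Sources

G. Benfatto, A. Giuliani, V. Mastropietro, Ann. Henri Poincaré 7 (2006) 809–898 = arXiv:cond-mat/0507686, §2.7 (2.70)–(2.71a), §2.8 (2.77),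
(2.82)–(2.84), (2.88)–(2.90), App. A3 Lemma A3.1 [`BenfattoGiulianiMastropietro2006`].
-/

noncomputable section

namespace Literature.MathematicalPhysics.QuantumLattice

open GrassmannAlgebra Finset Literature.Probability.LatticeModels

variable {L M : ℕ} [NeZero L] [NeZero M] {N N' : ℕ}

omit [NeZero L] [NeZero M] in
/-- Splitting a sum over tuples of (position, label) pairs into the label tuples and the position tuples. [folklore] -/
private theorem sum_tuple_prod_eq_sum_sum_w {α : Type*} [AddCommMonoid α] {P S : Type*} [Fintype P] [Fintype S] (n : ℕ)
    (g : (Fin n → P × S) → α) : ∑ Y, g Y = ∑ σ : Fin n → S, ∑ x : Fin n → P, g (fun i => (x i, σ i)) := by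
  rw [← (Equiv.arrowProdEquivProdArrow (Fin n) (fun _ => P) (fun _ => S)).symm.sum_comp, Fintype.sum_prod_type, sum_comm]
  rfl

/-- **Weighted prescribed-legs sizes across a plateau pair, split by a class of coarse label tuples** (BGM 2006 §2.8 (2.77), (2.82)–(2.84),
(2.88)–(2.90), App. A3 Lemma A3.1): as `hubbardSectorPrescribedSum_refine_le_split_of_plateau_pair`, with a weight `wf ≥ 0` on the fine position tuples
dominated by a coarse weight `wc ≥ 0` times leg factors `ω ≥ 0` (`wf x″ ≤ wc x′ · ∏_i ω(x″_i, x′_i)`), ω-WEIGHTED per-pair position sums of the overlap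
kernel `‖E(F′)S(F̃)‖` (`≤ c₁` fine summed, `≤ c₁r` coarse summed) and `N₁`/`N₂` bounding the `wc`-weighted coarse prescribed sums:
`ε_x^m Σ_{σ″ ∈ A″, σ″|_E = τ″|_E} Σ_{x″_p = x} wf(x″)‖W_{F′,σ″}(x″)‖ ≤ c₁^m · c₁r · ρ^{|E|} · ε_x^m · (ε_x · (R₁N₁ + R₂N₂))`.
[cite: BenfattoGiulianiMastropietro2006, §2.8 (2.77), (2.82)-(2.84) and (2.88)-(2.90), App. A3 Lemma A3.1] -/
theorem hubbardSectorPrescribedSumWt_refine_le_split_of_plateau_pair {β : ℝ} (hβ : 0 < β) (F Ft : Fin N → FreqMomentum L M → ℂ)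
    (hFF : ∀ ω k, Ft ω k * F ω k = F ω k) (hF0 : ∀ k, ∑ ω, F ω k = 0 → ∀ ω, F ω k = 0) (F' : Fin N' → FreqMomentum L M → ℂ)
    (hF'pl : ∀ (ω' : Fin N') (k : FreqMomentum L M), F' ω' k ≠ 0 → ∑ ω, F ω k = 1) (G : HubbardGrassmann L M)
    (child : Fin N' → Fin N → Prop) [DecidableRel child]
    (hchild : ∀ ω'' ω', ¬ child ω'' ω' → ∀ k, F' ω'' k * Ft ω' k = 0)
    {c₁ c₁r ρc R₁ R₂ N₁ N₂ : ℝ} (hc₁0 : 0 ≤ c₁) (hc₁r0 : 0 ≤ c₁r) (hR₁ : 0 ≤ R₁) (hR₂ : 0 ≤ R₂) (hN₁0 : 0 ≤ N₁) (hN₂0 : 0 ≤ N₂)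
    (ω : SpaceTimeIdx L M → SpaceTimeIdx L M → ℝ) (hω0 : ∀ x'' x', 0 ≤ ω x'' x')
    (hcol₁ : ∀ (ℓ'' : SectorLeg N') (X' : SpaceTimeIdx L M × SectorLeg N),
      ∑ x'' : SpaceTimeIdx L M, ‖(sectorAnalysisMatrix L M β F' * sectorSubMatrix L M β Ft) (x'', ℓ'') X'‖ * ω x'' X'.1 ≤ c₁)
    (hrow₁ : ∀ (X'' : SpaceTimeIdx L M × SectorLeg N') (ℓ' : SectorLeg N),
      ∑ x' : SpaceTimeIdx L M, ‖(sectorAnalysisMatrix L M β F' * sectorSubMatrix L M β Ft) X'' (x', ℓ')‖ * ω X''.1 x' ≤ c₁r)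
    (hρ : ∀ ℓ'' : SectorLeg N',
      (((univ.filter fun ℓ' : SectorLeg N => child ℓ''.1.1 ℓ'.1.1 ∧ ℓ'.1.2 = ℓ''.1.2 ∧ ℓ'.2 = ℓ''.2).card : ℝ)) ≤ ρc)
    (m : ℕ) (A'' : Finset (Fin (m + 1) → SectorLeg N')) (B : Finset (Fin (m + 1) → SectorLeg N))
    (E : Finset (Fin (m + 1))) (τ'' : Fin (m + 1) → SectorLeg N') (p : Fin (m + 1)) (hp : p ∈ E)
    (hRoff : ∀ σ' : Fin (m + 1) → SectorLeg N, σ' ∉ B →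
      (((A''.filter fun σ'' => (∀ e ∈ E, σ'' e = τ'' e) ∧
          ∀ i, child (σ'' i).1.1 (σ' i).1.1 ∧ (σ' i).1.2 = (σ'' i).1.2 ∧ (σ' i).2 = (σ'' i).2).card : ℝ)) ≤ R₁)
    (hRon : ∀ σ' : Fin (m + 1) → SectorLeg N, σ' ∈ B →
      (((A''.filter fun σ'' => (∀ e ∈ E, σ'' e = τ'' e) ∧
          ∀ i, child (σ'' i).1.1 (σ' i).1.1 ∧ (σ' i).1.2 = (σ'' i).1.2 ∧ (σ' i).2 = (σ'' i).2).card : ℝ)) ≤ R₂)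
    (wf wc : (Fin (m + 1) → SpaceTimeIdx L M) → ℝ) (hwf0 : ∀ x'', 0 ≤ wf x'') (hwc0 : ∀ x', 0 ≤ wc x')
    (hw : ∀ (x'' x' : Fin (m + 1) → SpaceTimeIdx L M), wf x'' ≤ wc x' * ∏ i, ω (x'' i) (x' i))
    (hN₁ : ∀ (τ' : Fin (m + 1) → SectorLeg N) (y : SpaceTimeIdx L M),
      imagTimeWeight β M ^ m * ∑ σ' ∈ univ.filter (fun σ' : Fin (m + 1) → SectorLeg N => ∀ e ∈ E, σ' e = τ' e),
        ∑ x' ∈ univ.filter (fun x' : Fin (m + 1) → SpaceTimeIdx L M => x' p = y),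
          wc x' * ‖sectorisedKernel L M β F G (m + 1) σ' x'‖ ≤ N₁)
    (hN₂ : ∀ (τ' : Fin (m + 1) → SectorLeg N) (y : SpaceTimeIdx L M),
      imagTimeWeight β M ^ m * ∑ σ' ∈ B.filter (fun σ' : Fin (m + 1) → SectorLeg N => ∀ e ∈ E, σ' e = τ' e),
        ∑ x' ∈ univ.filter (fun x' : Fin (m + 1) → SpaceTimeIdx L M => x' p = y),
          wc x' * ‖sectorisedKernel L M β F G (m + 1) σ' x'‖ ≤ N₂)
    (x : SpaceTimeIdx L M) :
    imagTimeWeight β M ^ m * ∑ σ'' ∈ A''.filter (fun σ'' => ∀ e ∈ E, σ'' e = τ'' e),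
        ∑ x'' ∈ univ.filter (fun x'' : Fin (m + 1) → SpaceTimeIdx L M => x'' p = x),
          wf x'' * ‖sectorisedKernel L M β F' G (m + 1) σ'' x''‖ ≤
      c₁ ^ m * c₁r * ρc ^ E.card * imagTimeWeight β M ^ m * (imagTimeWeight β M * (R₁ * N₁ + R₂ * N₂)) := by
  have hε : 0 ≤ imagTimeWeight β M := imagTimeWeight_nonneg hβ.le M
  set T : SpaceTimeIdx L M × SectorLeg N' → SpaceTimeIdx L M × SectorLeg N → ℂ :=
    fun X'' X' => (sectorAnalysisMatrix L M β F' * sectorSubMatrix L M β Ft) X'' X' with hT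
  set W : (Fin (m + 1) → SectorLeg N) → (Fin (m + 1) → SpaceTimeIdx L M) → ℂ :=
    (((imagTimeWeight β M : ℝ) : ℂ) ^ (m + 1)) • sectorisedKernel L M β F G (m + 1) with hW
  -- the fine sectorised kernels are the leg-wise transform of `ε^{m+1} ·` the coarse ones
  have hker : ∀ (σ'' : Fin (m + 1) → SectorLeg N') (x'' : Fin (m + 1) → SpaceTimeIdx L M),
      sectorisedKernel L M β F' G (m + 1) σ'' x'' =
      ∑ σ' : Fin (m + 1) → SectorLeg N, ∑ x' : Fin (m + 1) → SpaceTimeIdx L M, (∏ i, T (x'' i, σ'' i) (x' i, σ' i)) * W σ' x' := by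
    intro σ'' x''
    have h1 : kernel ℂ (ExteriorAlgebra.map (Matrix.toLin' (sectorAnalysisMatrix L M β F')) G) (m + 1) (fun i => (x'' i, σ'' i)) =
        sectorisedKernel L M β F' G (m + 1) σ'' x'' := by
      simpa only using kernel_map_sectorAnalysis β F' G (m + 1) (fun i => (x'' i, σ'' i))
    rw [← h1, map_sectorAnalysis_eq_map_comp_sectorPreimage_of_plateau hβ.ne' F Ft hFF hF0 F' hF'pl G, kernel_map,
      LinearMap.toMatrix'_comp, LinearMap.toMatrix'_toLin', LinearMap.toMatrix'_toLin',
      sum_tuple_prod_eq_sum_sum_w (m + 1) (fun Y' : Fin (m + 1) → SpaceTimeIdx L M × SectorLeg N =>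
        (∏ i, T (x'' i, σ'' i) (Y' i)) * kernel ℂ (sectorPreimage β F G) (m + 1) Y')]
    refine sum_congr rfl fun σ' _ => sum_congr rfl fun x' _ => ?_
    congr 1
    simpa only [hW, Pi.smul_apply, smul_eq_mul] using kernel_sectorPreimage_eq_sectorisedKernel β F G (m + 1) (fun i => (x' i, σ' i))
  -- the prescribed sums of `ε^{m+1} · W_F` are `ε^{m+1} ·` those of `W_F`
  have hnW : ∀ σ' x', ‖W σ' x'‖ = imagTimeWeight β M ^ (m + 1) * ‖sectorisedKernel L M β F G (m + 1) σ' x'‖ := by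
    intro σ' x'
    rw [hW, Pi.smul_apply, Pi.smul_apply, smul_eq_mul, norm_mul, norm_pow, Complex.norm_real, Real.norm_of_nonneg hε]
  have hNW : ∀ (Bs : Finset (Fin (m + 1) → SectorLeg N)) (Nb : ℝ),
      (∀ (τ' : Fin (m + 1) → SectorLeg N) (y : SpaceTimeIdx L M),
        imagTimeWeight β M ^ m * ∑ σ' ∈ Bs.filter (fun σ' : Fin (m + 1) → SectorLeg N => ∀ e ∈ E, σ' e = τ' e),
          ∑ x' ∈ univ.filter (fun x' : Fin (m + 1) → SpaceTimeIdx L M => x' p = y),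
            wc x' * ‖sectorisedKernel L M β F G (m + 1) σ' x'‖ ≤ Nb) →
      ∀ (τ' : Fin (m + 1) → SectorLeg N) (y : SpaceTimeIdx L M),
        imagTimeWeight β M ^ m * ∑ σ' ∈ Bs.filter (fun σ' : Fin (m + 1) → SectorLeg N => ∀ e ∈ E, σ' e = τ' e),
          ∑ x' ∈ univ.filter (fun x' : Fin (m + 1) → SpaceTimeIdx L M => x' p = y), wc x' * ‖W σ' x'‖ ≤
          imagTimeWeight β M ^ (m + 1) * Nb := by
    intro Bs Nb hNb τ' y
    have hterm : ∀ σ' x', wc x' * ‖W σ' x'‖ =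
        imagTimeWeight β M ^ (m + 1) * (wc x' * ‖sectorisedKernel L M β F G (m + 1) σ' x'‖) := by
      intro σ' x'
      rw [hnW]
      ring
    simp_rw [hterm]
    rw [← sum_congr rfl fun σ' _ => mul_sum _ _ _, ← mul_sum, mul_left_comm]
    exact mul_le_mul_of_nonneg_left (hNb τ' y) (pow_nonneg hε _)
  have hmain := prescribedLegSumWt_refine_le_split (𝕜 := ℂ) hε T
    (fun (ℓ'' : SectorLeg N') (ℓ' : SectorLeg N) => child ℓ''.1.1 ℓ'.1.1 ∧ ℓ'.1.2 = ℓ''.1.2 ∧ ℓ'.2 = ℓ''.2)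
    (fun x'' ℓ'' x' ℓ' h => sectorAnalysis_mul_sectorSub_eq_zero_of_not_child β F' Ft child hchild x'' ℓ'' x' ℓ' h)
    hc₁0 hc₁r0 hR₁ hR₂ (mul_nonneg (pow_nonneg hε _) hN₁0) (mul_nonneg (pow_nonneg hε _) hN₂0) ω hω0
    (fun ℓ'' x' ℓ' => hcol₁ ℓ'' (x', ℓ')) (fun x'' ℓ'' ℓ' => hrow₁ (x'', ℓ'') ℓ') (fun ℓ'' => by convert hρ ℓ'' using 4)
    A'' B E τ'' p hp (fun σ' hσ' => by convert hRoff σ' hσ' using 4) (fun σ' hσ' => by convert hRon σ' hσ' using 4)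
    W wf wc hwf0 hwc0 hw (hNW univ N₁ hN₁) (hNW B N₂ hN₂) x
  calc imagTimeWeight β M ^ m * ∑ σ'' ∈ A''.filter (fun σ'' => ∀ e ∈ E, σ'' e = τ'' e),
        ∑ x'' ∈ univ.filter (fun x'' : Fin (m + 1) → SpaceTimeIdx L M => x'' p = x),
          wf x'' * ‖sectorisedKernel L M β F' G (m + 1) σ'' x''‖
      = imagTimeWeight β M ^ m * ∑ σ'' ∈ A''.filter (fun σ'' => ∀ e ∈ E, σ'' e = τ'' e),
          ∑ x'' ∈ univ.filter (fun x'' : Fin (m + 1) → SpaceTimeIdx L M => x'' p = x),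
            wf x'' * ‖∑ σ' : Fin (m + 1) → SectorLeg N, ∑ x' : Fin (m + 1) → SpaceTimeIdx L M,
              (∏ i, T (x'' i, σ'' i) (x' i, σ' i)) * W σ' x'‖ := by
        refine congrArg _ (sum_congr rfl fun σ'' _ => sum_congr rfl fun x'' _ => ?_)
        rw [hker σ'' x'']
    _ ≤ c₁ ^ m * c₁r * ρc ^ E.card * (R₁ * (imagTimeWeight β M ^ (m + 1) * N₁) + R₂ * (imagTimeWeight β M ^ (m + 1) * N₂)) := hmain
    _ = c₁ ^ m * c₁r * ρc ^ E.card * imagTimeWeight β M ^ m * (imagTimeWeight β M * (R₁ * N₁ + R₂ * N₂)) := by ring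

end Literature.MathematicalPhysics.QuantumLattice

end
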